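import Summits.Langlands.Langlands.Theorems.IrreducibilityBySelfDualityIrreducibleOffSectorMonomial
import Summits.Langlands.Langlands.Theorems.IrreducibilityBySelfDualityIrreducibleOffSectorMackeyInduced
import Literature.NumberTheory.Automorphic.AutomorphicInductionOrbitRegular
import HarnessLib

/-!
# Automorphic-induction ASCENT of the conclusion of `IrreducibleOffSector` (every rank)
(crux stmt-Langlands-14329 `IrreducibilityBySelfDuality.IrreducibleOffSector`, line `Sketch`;
`--supports` file, continuation lead c4; sequel of `…Monomial` (p122296) and `…MackeyInduced`
(p122635))

The monomial region (`isIrreducible_of_isAutomorphicInductionAlong_one`) is the case `m = 1` of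
the following structural operator, the third closure property of the crux's conclusion after
twists (p120193) and base-change descent (p121124): it ASCENDS along automorphic induction.

**Theorem** (`isIrreducible_of_isAutomorphicInductionAlong`).  Let `E/K` be finite Galois, `τ`
an automorphic representation datum of `GL_m(𝔸_E)`, `P` one of `GL_n(𝔸_K)` automorphically
induced from `τ` (`IsAutomorphicInductionAlong τ P`, Arthur–Clozel Ch. 3 Def. 6.1), `τ`
Galois-regular (`t_{τ, g ·} ≠ t_{τ, ·}` on an infinite set for each `g ≠ 1`; automatic for `P`
cuspidal by Arthur–Clozel Cor. 6.5), and suppose `τ` has an IRREDUCIBLE `ℓ`-adic avatar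
`ψ : Γ_E → GL_m(ℚ̄_ℓ)` along `ι` (for instance: `τ` has some avatar and the crux's conclusion
holds for `τ` over `E`).  Then every `ρ : Γ_K → GL_n(ℚ̄_ℓ)` Satake–Frobenius compatible with
`(P, ι)` almost everywhere is irreducible.

Proof: as in rank one — `Ind ψ` is compatible with `P` a.e.
(`eventually_satakeFrobCompatibleAt_induce_rank`, the induced Frobenius package
`isUnramifiedAt_and_hasFrobCharpolyAt_induce` + `hostPoly_eq_arithFrobPolyOfSatake`) and irreducible
by Mackey in every rank (`isIrreducible_induce_of_not_conj`), the conjugates `ψ^{r_i⁻¹}` being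
pairwise non-conjugate because a conjugation `ψ^b = Q ψ^a Q⁻¹` gives equal Frobenius polynomials
(`charpoly_conj`) and hence `t_{τ, g w} = t_{τ, w}` a.e. for `g = ā b̄⁻¹ ≠ 1`
(`not_conj_of_satakeRegular`); then the CBN transfer p79199.  Crux binder shape:
`irreducibleOffSector_conclusion_of_induction` — the crux's conclusion for `π = AI_{E/K}(τ)`
follows from an irreducible avatar of the Galois-regular `τ`; in particular FROM THE CRUX OVER `E`
for `τ` (cuspidal, L-algebraic, off-sector over `E`) once `τ` has any avatar (`…_of_slice`).

References: J. Arthur, L. Clozel, Ann. of Math. Stud. 120 (1989), Ch. 3 §6; J.-P. Serre, *Linear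
representations of finite groups* (1977), §7.4.
-/

noncomputable section

set_option linter.dupNamespace false

open scoped NumberField Classical Matrix Polynomial
open Filter IsDedekindDomain Polynomial MeasureTheory
open Literature.NumberTheory.Automorphic Literature.NumberTheory.GaloisRepresentations
open Summit.Langlands
open Summit.Langlands.Langlands.Theorems.HostInducedRep.GrsExplicitDescent (hostPoly
  hostPoly_eq_arithFrobPolyOfSatake)

namespace Summit.Langlands.Langlands.Theorems.IrreducibleOffSector

/-! ## 1. `Ind ψ` is compatible with `P = AI(τ)` a.e., every rank -/

section Compat

variable {K E : Type} [Field K] [NumberField K] [Field E] [NumberField E] [Algebra K E]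
  [IsGalois K E] {n m ℓ : ℕ} [Fact ℓ.Prime] {hK : isCompact_glFiniteIntegralLevel n K}
  {hE : isCompact_glFiniteIntegralLevel m E}

/-- **`Ind_{Γ_E}^{Γ_K} ψ` is Satake–Frobenius compatible with `P = AI_{E/K}(τ)` almost everywhere**,
`τ` of any rank `m` with avatar `ψ` (relabelled to rank `n` along `e : Fin (d * m) ≃ Fin n`) — the
proof of the rank-one `eventually_satakeFrobCompatibleAt_induce` verbatim.
[cite: ArthurClozelAMS120, Ch. 3 Def. 6.1] -/
theorem eventually_satakeFrobCompatibleAt_induce_rank (ι : PadicAlgCl ℓ ≃+* ℂ)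
    (τ : AutomorphicRepData (AutomorphyDatum.gl m E hE))
    (P : AutomorphicRepData (AutomorphyDatum.gl n K hK)) (hAI : IsAutomorphicInductionAlong τ P)
    (ψ : FramedGaloisRep E (PadicAlgCl ℓ) m)
    (hψ : ∀ᶠ w : HeightOneSpectrum (𝓞 E) in cofinite, SatakeFrobCompatibleAt ι τ ψ w)
    {d : ℕ} (hd : Module.finrank K E = d) (e : Fin (d * m) ≃ Fin n) :
    ∀ᶠ v : HeightOneSpectrum (𝓞 K) in cofinite,
      SatakeFrobCompatibleAt ι P (FramedRep.reindex e (ψ.induce K hd)) v := by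
  classical
  have hunr : ∀ᶠ v : HeightOneSpectrum (𝓞 K) in cofinite, v.asIdeal.ramificationIdxIn (𝓞 E) = 1 :=
    (Filter.eventually_cofinite.2 (finite_setOf_not_isUnramifiedIn K E)).mono
      fun v hv ↦ ramificationIdxIn_eq_one_of_isUnramifiedIn hv
  have habove := eventually_forall_under_eq (F := K) hψ
  filter_upwards [hunr, habove, hAI] with v hv hgood hind
  have hβex : ∀ w : HeightOneSpectrum (𝓞 E), ∃ β : Multiset ℂ, w.asIdeal.under (𝓞 K) = v.asIdeal →
      τ.HasSatakeParamAt w β ∧ ψ.IsUnramifiedAt w ∧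
        ψ.HasFrobCharpolyAt w (arithFrobPolyOfSatake ι w.residueCard 1 β) := by
    intro w
    by_cases hw : w.asIdeal.under (𝓞 K) = v.asIdeal
    · obtain ⟨β, hβ⟩ := hgood w hw
      exact ⟨β, fun _ ↦ hβ⟩
    · exact ⟨∅, fun h ↦ absurd h hw⟩
  choose β hβ using hβex
  obtain ⟨α, hPα, hpoly⟩ := hind β fun w hw ↦ (hβ w hw).1
  obtain ⟨hIunr, hIchar⟩ := isUnramifiedAt_and_hasFrobCharpolyAt_induce K hd ψ hv
    (fun w ↦ arithFrobPolyOfSatake ι w.residueCard 1 (β w)) fun w hw ↦ (hβ w hw).2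
  have htwist : (fun w : HeightOneSpectrum (𝓞 E) ↦ (β w).map (fun a ↦ a * (1 : ℂ))) = β := by
    funext w
    rw [show (fun a : ℂ ↦ a * 1) = id from funext fun a ↦ mul_one a, Multiset.map_id]
  have hhost : hostPoly ι 1 β (fun _ ↦ (1 : ℂ)) v = arithFrobPolyOfSatake ι v.residueCard 1 α :=
    hostPoly_eq_arithFrobPolyOfSatake ι 1 β (fun _ ↦ 1) v α (by rw [htwist]; exact hpoly)
  have hhost' : hostPoly ι 1 β (fun _ ↦ (1 : ℂ)) v =
      ∏ᶠ w ∈ {w : HeightOneSpectrum (𝓞 E) | w.under (𝓞 K) = v},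
        expand (PadicAlgCl ℓ) (w.asIdeal.inertiaDeg (𝓞 K))
          (arithFrobPolyOfSatake ι w.residueCard 1 (β w)) := by
    rw [hostPoly]
    exact finprod_mem_congr rfl fun w _ ↦ by rw [congrFun htwist w]
  refine ⟨α, hPα, (FramedGaloisRep.isUnramifiedAt_reindex_iff v e _).2 hIunr,
    (FramedGaloisRep.hasFrobCharpolyAt_reindex_iff v e _ _).2 ?_⟩
  rw [← hhost, hhost']
  exact hIchar

end Compat

/-! ## 2. Galois-regularity of `τ` makes the conjugates of `ψ` pairwise non-conjugate -/

section Regular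

variable {K E : Type} [Field K] [NumberField K] [Field E] [NumberField E] [Algebra K E]
  [IsGalois K E] {m ℓ : ℕ} [Fact ℓ.Prime] {hE : isCompact_glFiniteIntegralLevel m E}

omit [NumberField K] in
/-- **A conjugate `ψ^a` of the avatar is the avatar of `τ ∘ ā`** (every rank): for almost every
`w` and every Satake parameter `α` of `τ` at `ā • w`, `ψ^a` is unramified at `w` with Frobenius
polynomial `arithFrobPolyOfSatake ι q_w 1 α`. [folklore] -/
theorem eventually_outerConj_compatible_rank (ι : PadicAlgCl ℓ ≃+* ℂ)
    (τ : AutomorphicRepData (AutomorphyDatum.gl m E hE)) (ψ : FramedGaloisRep E (PadicAlgCl ℓ) m)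
    (hψ : ∀ᶠ w : HeightOneSpectrum (𝓞 E) in cofinite, SatakeFrobCompatibleAt ι τ ψ w)
    (a : Field.absoluteGaloisGroup K) :
    ∀ᶠ w : HeightOneSpectrum (𝓞 E) in cofinite, ∀ α : Multiset ℂ,
      τ.HasSatakeParamAt (absGaloisQuot K E a • w) α →
        (ψ.outerConj a).IsUnramifiedAt w ∧
          (ψ.outerConj a).HasFrobCharpolyAt w (arithFrobPolyOfSatake ι w.residueCard 1 α) := by
  have hinj : Function.Injective fun w : HeightOneSpectrum (𝓞 E) ↦ absGaloisQuot K E a • w :=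
    MulAction.injective _
  filter_upwards [hinj.tendsto_cofinite.eventually hψ] with w hw α hα
  obtain ⟨α', hα', hunr, hchar⟩ := hw
  have hαα : α' = α := τ.hasSatakeParamAt_unique_holds hα' hα
  subst hαα
  exact ⟨(FramedGaloisRep.isUnramifiedAt_outerConj_iff a ψ w).2 hunr,
    (FramedGaloisRep.hasFrobCharpolyAt_outerConj_iff a ψ w _).2
      (by rw [arithFrobPolyOfSatake_one_eq ι w.residueCard (absGaloisQuot K E a • w).residueCard]
          exact hchar)⟩

/-- **Galois-regular `τ` ⇒ the conjugates `ψ^{r_i⁻¹}` of its avatar are pairwise NON-CONJUGATE**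
(every rank): if `ψ^{r_j⁻¹} = Q ψ^{r_i⁻¹} Q⁻¹` then, with `a = r_i⁻¹`, `b = r_j⁻¹`,
`g = ā b̄⁻¹ ≠ 1` (`absGaloisQuot_cosetRep_ne_one`), the conjugate `ψ^b` has at `b̄⁻¹ • w` the
Frobenius polynomial of `t_{τ,w}` (`eventually_outerConj_compatible_rank`), hence so has `ψ^a`
(`charpoly_conj`), i.e. `ψ` at `g • w`; comparing with the avatar at `g • w`
(`hasFrobCharpolyAt_unique_framed`, `arithFrobPolyOfSatake_one_injective`) gives
`t_{τ, g w} = t_{τ, w}` for almost all `w`, contradicting regularity.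
[cite: ArthurClozelAMS120, Ch. 3 Lemma 6.4] -/
theorem not_conj_of_satakeRegular {d : ℕ} (hd : Module.finrank K E = d) (ι : PadicAlgCl ℓ ≃+* ℂ)
    (τ : AutomorphicRepData (AutomorphyDatum.gl m E hE)) (ψ : FramedGaloisRep E (PadicAlgCl ℓ) m)
    (hψ : ∀ᶠ w : HeightOneSpectrum (𝓞 E) in cofinite, SatakeFrobCompatibleAt ι τ ψ w)
    (hreg : ∀ g : E ≃ₐ[K] E, g ≠ 1 →
      ¬ ∀ᶠ w : HeightOneSpectrum (𝓞 E) in cofinite, ∀ α : Multiset ℂ,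
          τ.HasSatakeParamAt w α → τ.HasSatakeParamAt (g • w) α) :
    ∀ i j : Fin d, i ≠ j → ∀ Q : GL (Fin m) (PadicAlgCl ℓ),
      ψ.outerConj (absGaloisCosetRep K E hd j)⁻¹ ≠
        FramedRep.conj Q (ψ.outerConj (absGaloisCosetRep K E hd i)⁻¹) := by
  haveI : FiniteDimensional K E := Module.Finite.of_restrictScalars_finite ℚ K E
  intro i j hij Q hab
  obtain ⟨a, ha⟩ : ∃ a, a = (absGaloisCosetRep K E hd i)⁻¹ := ⟨_, rfl⟩
  obtain ⟨b, hb⟩ : ∃ b, b = (absGaloisCosetRep K E hd j)⁻¹ := ⟨_, rfl⟩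
  have hg1 : absGaloisQuot K E (a * b⁻¹) ≠ 1 := by
    rw [ha, hb]; exact absGaloisQuot_cosetRep_ne_one hd hij
  rw [← ha, ← hb] at hab
  refine hreg (absGaloisQuot K E (a * b⁻¹)) hg1 ?_
  have hb' := eventually_outerConj_compatible_rank ι τ ψ hψ b
  have hinj : Function.Injective fun w : HeightOneSpectrum (𝓞 E) ↦ (absGaloisQuot K E b)⁻¹ • w :=
    MulAction.injective _
  have hginj : Function.Injective fun w : HeightOneSpectrum (𝓞 E) ↦ absGaloisQuot K E (a * b⁻¹) • w :=
    MulAction.injective _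
  filter_upwards [hinj.tendsto_cofinite.eventually hb', hginj.tendsto_cofinite.eventually hψ]
    with w hwb hwg α hα
  -- `ψ^b` has Frobenius polynomial `arith α` at `b̄⁻¹ • w`; normalise `q` to `q_w` first
  have h1 := (hwb α (by rwa [smul_inv_smul])).2
  rw [arithFrobPolyOfSatake_one_eq ι ((absGaloisQuot K E b)⁻¹ • w).residueCard w.residueCard] at h1
  -- hence so has `ψ^a = Q⁻¹-conjugate`: equal characteristic polynomials
  have h1a : (ψ.outerConj a).HasFrobCharpolyAt ((absGaloisQuot K E b)⁻¹ • w)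
      (arithFrobPolyOfSatake ι w.residueCard 1 α) := by
    intro 𝔓 h𝔓 σ hσ
    rw [← charpoly_conj Q (ψ.outerConj a) σ, ← hab]
    exact h1 𝔓 h𝔓 σ hσ
  -- i.e. `ψ` at `ā • b̄⁻¹ • w = g • w`
  have h2 : ψ.HasFrobCharpolyAt (absGaloisQuot K E (a * b⁻¹) • w)
      (arithFrobPolyOfSatake ι w.residueCard 1 α) := by
    have := (FramedGaloisRep.hasFrobCharpolyAt_outerConj_iff a ψ _ _).1 h1a
    rw [smul_smul, ← map_inv, ← map_mul] at this
    exact this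
  obtain ⟨α', hα', -, hchar'⟩ := hwg
  rw [arithFrobPolyOfSatake_one_eq ι _ w.residueCard] at hchar'
  have hαα : α' = α :=
    arithFrobPolyOfSatake_one_injective ι _ _ (hasFrobCharpolyAt_unique_framed hchar' h2)
  rw [← hαα]
  exact hα'

/-- **Cuspidality of `P = AI_{E/K}(τ)` forces `τ` to be Galois-regular, every rank** (Arthur–Clozel
1989, Ch. 3, Cor. 6.5 with Lemma 6.4) — `IsAutomorphicInductionAlong.not_eventually_hasSatakeParamAt_smul_of_cuspidal`
with its four Jacquet–Shalika / multiplicity-one inputs kept as hypotheses: (2.3) in rank `n` over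
`K` (`h23K`), and (2.2), (2.3), multiplicity one in rank `m` over `E` (theorems of the tree for
`m = 1`, cf. `satakeRegular_of_cuspidal_induction`; named facts beyond).
[cite: ArthurClozelAMS120, Ch. 3, Lemma 6.4 and Cor. 6.5] -/
theorem satakeRegular_of_cuspidal_induction_rank {n : ℕ} {hK : isCompact_glFiniteIntegralLevel n K}
    (hm : 0 < m)
    (h23K : ∀ (μ : Measure (AdelicGroupData.gl n K).automorphicQuotient)
      [(AdelicGroupData.gl n K).IsAutomorphicMeasure μ],
      JacquetShalika1981_partialPairL_pole_of_eq_conj (n := n) (K := K) (μ := μ))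
    (h22E : ∀ (ν : Measure (AdelicGroupData.gl m E).automorphicQuotient)
      [(AdelicGroupData.gl m E).IsAutomorphicMeasure ν],
      JacquetShalika1981_partialPairL_at_one_of_ne_conj (n := m) (K := E) (μ := ν))
    (h23E : ∀ (ν : Measure (AdelicGroupData.gl m E).automorphicQuotient)
      [(AdelicGroupData.gl m E).IsAutomorphicMeasure ν],
      JacquetShalika1981_partialPairL_pole_of_eq_conj (n := m) (K := E) (μ := ν))
    (hm1E : ∀ (ν : Measure (AdelicGroupData.gl m E).automorphicQuotient)
      [(AdelicGroupData.gl m E).IsAutomorphicMeasure ν], multiplicity_one_gl m E ν)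
    (τ : CuspidalAutomorphicRepData m E hE) (P : CuspidalAutomorphicRepData n K hK)
    (hAI : IsAutomorphicInductionAlong τ.1 P.1) :
    ∀ g : E ≃ₐ[K] E, g ≠ 1 →
      ¬ ∀ᶠ w : HeightOneSpectrum (𝓞 E) in cofinite, ∀ α : Multiset ℂ,
          τ.1.HasSatakeParamAt w α → τ.1.HasSatakeParamAt (g • w) α :=
  fun _ hg ↦ hAI.not_eventually_hasSatakeParamAt_smul_of_cuspidal hm h23K h22E h23E hm1E hg

end Regular

/-! ## 3. The ascent -/

section Main

/-- **Automorphic-induction ASCENT of the crux's conclusion** (every rank, unconditional).  Let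
`E/K` be finite Galois, `τ` an automorphic datum of `GL_m(𝔸_E)`, `P` one of `GL_n(𝔸_K)`
automorphically induced from `τ` (`IsAutomorphicInductionAlong τ P`), `τ` Galois-regular, and
`ψ : Γ_E → GL_m(ℚ̄_ℓ)` an IRREDUCIBLE avatar of `τ` along `ι`.  Then every
`ρ : Γ_K → GL_n(ℚ̄_ℓ)` a.e.-compatible with `(P, ι)` is irreducible: `Ind ψ` is compatible with
`P` a.e. (`eventually_satakeFrobCompatibleAt_induce_rank`) and irreducible by Mackey
(`isIrreducible_induce_of_not_conj`, `not_conj_of_satakeRegular`), and the CBN transfer p79199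
concludes. [cite: ArthurClozelAMS120, Ch. 3 Def. 6.1 and Lemma 6.4]
[cite: SerreLinearRepresentations1977, §7.3 Prop. 22] -/
theorem isIrreducible_of_isAutomorphicInductionAlong {K E : Type} [Field K] [NumberField K]
    [Field E] [NumberField E] [Algebra K E] [IsGalois K E] {n m ℓ : ℕ} [Fact ℓ.Prime]
    {hK : isCompact_glFiniteIntegralLevel n K} {hE : isCompact_glFiniteIntegralLevel m E}
    (ι : PadicAlgCl ℓ ≃+* ℂ) (τ : AutomorphicRepData (AutomorphyDatum.gl m E hE))
    (P : AutomorphicRepData (AutomorphyDatum.gl n K hK)) (hAI : IsAutomorphicInductionAlong τ P)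
    (hreg : ∀ g : E ≃ₐ[K] E, g ≠ 1 →
      ¬ ∀ᶠ w : HeightOneSpectrum (𝓞 E) in cofinite, ∀ α : Multiset ℂ,
          τ.HasSatakeParamAt w α → τ.HasSatakeParamAt (g • w) α)
    (ψ : FramedGaloisRep E (PadicAlgCl ℓ) m) (hψirr : ψ.toGaloisRep.IsIrreducible)
    (hψ : ∀ᶠ w : HeightOneSpectrum (𝓞 E) in cofinite, SatakeFrobCompatibleAt ι τ ψ w)
    (ρ : FramedGaloisRep K (PadicAlgCl ℓ) n)
    (hρ : ∀ᶠ v : HeightOneSpectrum (𝓞 K) in cofinite, SatakeFrobCompatibleAt ι P ρ v) :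
    ρ.toGaloisRep.IsIrreducible := by
  haveI : FiniteDimensional K E := Module.Finite.of_restrictScalars_finite ℚ K E
  haveI : CharZero E := charZero_of_injective_algebraMap (algebraMap K E).injective
  set d := Module.finrank K E with hdd
  have hd : Module.finrank K E = d := rfl
  have hn : d * m = n := by rw [hAI.rank_eq, hdd]; ring
  let e : Fin (d * m) ≃ Fin n := finCongr hn
  have h₀ := eventually_satakeFrobCompatibleAt_induce_rank ι τ P hAI ψ hψ hd e
  have hirr : (ψ.induce K hd).toGaloisRep.IsIrreducible :=
    isIrreducible_induce_of_not_conj K hd ψ hψirr (not_conj_of_satakeRegular hd ι τ ψ hψ hreg)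
  have hirr₀ : FramedGaloisRep.toGaloisRep (K := K)
      (FramedRep.reindex e (ψ.induce K hd)) |>.IsIrreducible :=
    isIrreducible_reindex e _ hirr
  exact isIrreducible_of_satakeFrobCompatible P ι hirr₀ h₀ hρ

/-- **Ascent from the crux's conclusion over `E`**: if every avatar of `τ` is irreducible (the
conclusion of `IrreducibleOffSector` for `τ` over `E`), `τ` has SOME avatar along `ι`, `τ` is
Galois-regular and `P = AI_{E/K}(τ)`, then every `ρ` a.e.-compatible with `(P, ι)` is irreducible.
[cite: ArthurClozelAMS120, Ch. 3 Def. 6.1 and Lemma 6.4] -/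
theorem isIrreducible_of_isAutomorphicInductionAlong_of_slice {K E : Type} [Field K]
    [NumberField K] [Field E] [NumberField E] [Algebra K E] [IsGalois K E] {n m ℓ : ℕ}
    [Fact ℓ.Prime] {hK : isCompact_glFiniteIntegralLevel n K}
    {hE : isCompact_glFiniteIntegralLevel m E} (ι : PadicAlgCl ℓ ≃+* ℂ)
    (τ : AutomorphicRepData (AutomorphyDatum.gl m E hE))
    (hslice : ∀ ψ : FramedGaloisRep E (PadicAlgCl ℓ) m,
      (∀ᶠ w : HeightOneSpectrum (𝓞 E) in cofinite, SatakeFrobCompatibleAt ι τ ψ w) →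
        ψ.toGaloisRep.IsIrreducible)
    (hav : ∃ ψ : FramedGaloisRep E (PadicAlgCl ℓ) m,
      ∀ᶠ w : HeightOneSpectrum (𝓞 E) in cofinite, SatakeFrobCompatibleAt ι τ ψ w)
    (P : AutomorphicRepData (AutomorphyDatum.gl n K hK)) (hAI : IsAutomorphicInductionAlong τ P)
    (hreg : ∀ g : E ≃ₐ[K] E, g ≠ 1 →
      ¬ ∀ᶠ w : HeightOneSpectrum (𝓞 E) in cofinite, ∀ α : Multiset ℂ,
          τ.HasSatakeParamAt w α → τ.HasSatakeParamAt (g • w) α)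
    (ρ : FramedGaloisRep K (PadicAlgCl ℓ) n)
    (hρ : ∀ᶠ v : HeightOneSpectrum (𝓞 K) in cofinite, SatakeFrobCompatibleAt ι P ρ v) :
    ρ.toGaloisRep.IsIrreducible := by
  obtain ⟨ψ, hψ⟩ := hav
  exact isIrreducible_of_isAutomorphicInductionAlong ι τ P hAI hreg ψ (hslice ψ hψ) hψ ρ hρ

/-- **The ascent in the crux's binder shape.**  For every `n ≥ 1`, `K` and every cuspidal `π` on
`GL_n(𝔸_K)` automorphically induced from a Galois-regular automorphic datum `τ` of `GL_m(𝔸_E)`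
(`E/K` finite Galois) all of whose `ℓ`-adic avatars are irreducible and which has one along every
`ι`: every `ρ : Γ_K → GL_n(ℚ̄_ℓ)` a.e.-compatible with `(π, ι)` is irreducible (guard,
L-algebraicity and sector clause idle).  With `m = 1` this is the monomial region.
[cite: ArthurClozelAMS120, Ch. 3 Def. 6.1 and Lemma 6.4] -/
theorem irreducibleOffSector_conclusion_of_induction :
    ∀ (n : ℕ) (K : Type) [Field K] [NumberField K] (hcpt : isCompact_glFiniteIntegralLevel n K),
      0 < n → ∀ (π : CuspidalAutomorphicRepData n K hcpt),
        (∃ (E : Type) (_ : Field E) (_ : NumberField E) (_ : Algebra K E) (_ : IsGalois K E)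
            (m : ℕ) (hE : isCompact_glFiniteIntegralLevel m E)
            (τ : AutomorphicRepData (AutomorphyDatum.gl m E hE)),
          IsAutomorphicInductionAlong τ π.1 ∧
          (∀ g : E ≃ₐ[K] E, g ≠ 1 →
            ¬ ∀ᶠ w : HeightOneSpectrum (𝓞 E) in cofinite, ∀ α : Multiset ℂ,
                τ.HasSatakeParamAt w α → τ.HasSatakeParamAt (g • w) α) ∧
          ∀ (ℓ : ℕ) [Fact ℓ.Prime] (ι : PadicAlgCl ℓ ≃+* ℂ),
            (∃ ψ : FramedGaloisRep E (PadicAlgCl ℓ) m,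
              ∀ᶠ w : HeightOneSpectrum (𝓞 E) in cofinite, SatakeFrobCompatibleAt ι τ ψ w) ∧
            ∀ ψ : FramedGaloisRep E (PadicAlgCl ℓ) m,
              (∀ᶠ w : HeightOneSpectrum (𝓞 E) in cofinite, SatakeFrobCompatibleAt ι τ ψ w) →
                ψ.toGaloisRep.IsIrreducible) →
        π.1.IsLAlgebraic →
        ¬ (n = 3 ∧ NumberField.IsCMField K ∧
            ∃ T : InfinityType K n, π.1.HasInfinityType T ∧ T.IsRegular) →
        ∀ (ℓ : ℕ) [Fact ℓ.Prime] (ι : PadicAlgCl ℓ ≃+* ℂ) (ρ : FramedGaloisRep K (PadicAlgCl ℓ) n),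
          (∀ᶠ v : HeightOneSpectrum (𝓞 K) in cofinite, SatakeFrobCompatibleAt ι π.1 ρ v) →
            ρ.toGaloisRep.IsIrreducible := by
  intro n K _ _ hcpt _ π hind _ _ ℓ _ ι ρ hρ
  obtain ⟨E, _, _, _, _, m, hE, τ, hAI, hreg, hav⟩ := hind
  obtain ⟨hex, hslice⟩ := hav ℓ ι
  exact isIrreducible_of_isAutomorphicInductionAlong_of_slice ι τ hslice hex π.1 hAI hreg ρ hρ

end Main

end Summit.Langlands.Langlands.Theorems.IrreducibleOffSector

end
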